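import Summits.AtomisticToContinuum.Crystallization.Theorems.ExcessDecayLiouvillePoincare

/-!
# Route `ExcessDecayLiouville`: energy bound for Dirichlet corrections

Step (e′) (`DirichletResponse`, energy half) of the energy route for item `ExcessDecay`
(stmt-AtomisticToContinuum-9334).  For a displacement `w` supported in the sites of the ball `B_R(c)` and the coercivity
constant `κ` of `coercive_of_phononStability` (taken as the hypothesis schema `hκ`, exactly as in the Caccioppoli files):

* `mul_tsum_norm_sq_le_work` : `κ Σ' ‖w p‖² ≤ (400R/189 + 2)² · Σ'_p ⟪(L w)(p), w p⟫` (Poincaré × coercivity);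
* `tsum_norm_sq_le_of_residual` : if moreover `‖(L w)(p)‖ ≤ G` at every site of the support, then
  `κ Σ' ‖w p‖² ≤ (400R/189 + 2)² · G · Σ_{p ∈ supp} ‖w p‖` — only the residual ON the support enters, because `w` vanishes
  elsewhere; with `#supp ≤ (2R/(23/25)+1)³` and Cauchy–Schwarz this is the `ℓ²` smallness of the Dirichlet correction.

All `[folklore]`; helper lemmas, nothing here closes an item.
-/

noncomputable section

namespace Summit.AtomisticToContinuum.Crystallization.Theorems.ExcessDecayLiouville

open scoped BigOperators Topology InnerProductSpace RealInnerProductSpace Classical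
open Literature.MathematicalPhysics.StatisticalMechanics
open Summit.AtomisticToContinuum.Crystallization.Theorems.PhononStabilityNegative

section

variable {t : Fin 2 → (EuclideanSpace ℝ (Fin 3))} {A : (EuclideanSpace ℝ (Fin 3)) →L[ℝ] (EuclideanSpace ℝ (Fin 3))}

/-- **Energy bound for Dirichlet corrections**: `κ‖w‖₂² ≤ (400R/189+2)² Σ'⟪Lw, w⟫` for `w` supported in the sites of
`B_R(c)`. [folklore] -/
theorem mul_tsum_norm_sq_le_work (hA : Adm₀ A) (hI : Inner₀ t A) {κ : ℝ} (hκ0 : 0 ≤ κ)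
    (hκ : ∀ v : (EuclideanSpace ℝ (Fin 3)) → (EuclideanSpace ℝ (Fin 3)), (Function.support v).Finite → Function.support v ⊆ Sites₀ t A →
      κ * nnForm t A v ≤ ∑' p : Sites₀ t A, ⟪∑' q : Sites₀ t A,
        (if (p : (EuclideanSpace ℝ (Fin 3))) ≠ q then ((-((‖(p : (EuclideanSpace ℝ (Fin 3))) - q‖ ^ 2)⁻¹) ^ 7 + ((‖(p : (EuclideanSpace ℝ (Fin 3))) - q‖ ^ 2)⁻¹) ^ 4) • (v p - v q) + (2 * ⟪(p : (EuclideanSpace ℝ (Fin 3))) - q, v p - v q⟫ * (7 * ((‖(p : (EuclideanSpace ℝ (Fin 3))) - q‖ ^ 2)⁻¹) ^ 8 - 4 * ((‖(p : (EuclideanSpace ℝ (Fin 3))) - q‖ ^ 2)⁻¹) ^ 5)) • ((p : (EuclideanSpace ℝ (Fin 3))) - q)) else 0), v p⟫)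
    {w : (EuclideanSpace ℝ (Fin 3)) → (EuclideanSpace ℝ (Fin 3))} (hw : (Function.support w).Finite) (hwS : Function.support w ⊆ Sites₀ t A)
    {c : (EuclideanSpace ℝ (Fin 3))} {R : ℝ} (hR : 0 ≤ R) (hwR : Function.support w ⊆ Metric.closedBall c R) :
    κ * ∑' p : Sites₀ t A, ‖w p‖ ^ 2 ≤
      (400 * R / 189 + 2) ^ 2 * ∑' p : Sites₀ t A, ⟪∑' q : Sites₀ t A, (if (p : (EuclideanSpace ℝ (Fin 3))) ≠ q then ((-((‖(p : (EuclideanSpace ℝ (Fin 3))) - q‖ ^ 2)⁻¹) ^ 7 + ((‖(p : (EuclideanSpace ℝ (Fin 3))) - q‖ ^ 2)⁻¹) ^ 4) • (w p - w q) + (2 * ⟪(p : (EuclideanSpace ℝ (Fin 3))) - q, w p - w q⟫ * (7 * ((‖(p : (EuclideanSpace ℝ (Fin 3))) - q‖ ^ 2)⁻¹) ^ 8 - 4 * ((‖(p : (EuclideanSpace ℝ (Fin 3))) - q‖ ^ 2)⁻¹) ^ 5)) • ((p : (EuclideanSpace ℝ (Fin 3))) - q)) else 0), w p⟫ := by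
  have hP := tsum_norm_sq_le_mul_nnForm hA hI hw hR hwR
  have hC := hκ w hw hwS
  calc κ * ∑' p : Sites₀ t A, ‖w p‖ ^ 2
      ≤ κ * ((400 * R / 189 + 2) ^ 2 * nnForm t A w) := mul_le_mul_of_nonneg_left hP hκ0
    _ = (400 * R / 189 + 2) ^ 2 * (κ * nnForm t A w) := by ring
    _ ≤ (400 * R / 189 + 2) ^ 2 * ∑' p : Sites₀ t A, ⟪∑' q : Sites₀ t A, (if (p : (EuclideanSpace ℝ (Fin 3))) ≠ q then ((-((‖(p : (EuclideanSpace ℝ (Fin 3))) - q‖ ^ 2)⁻¹) ^ 7 + ((‖(p : (EuclideanSpace ℝ (Fin 3))) - q‖ ^ 2)⁻¹) ^ 4) • (w p - w q) + (2 * ⟪(p : (EuclideanSpace ℝ (Fin 3))) - q, w p - w q⟫ * (7 * ((‖(p : (EuclideanSpace ℝ (Fin 3))) - q‖ ^ 2)⁻¹) ^ 8 - 4 * ((‖(p : (EuclideanSpace ℝ (Fin 3))) - q‖ ^ 2)⁻¹) ^ 5)) • ((p : (EuclideanSpace ℝ (Fin 3))) - q)) else 0), w p⟫ :=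
        mul_le_mul_of_nonneg_left hC (by positivity)

/-- **Only the residual on the support enters**: if `‖(Lw)(p)‖ ≤ G` at the sites where `w p ≠ 0`, then
`κ‖w‖₂² ≤ (400R/189+2)² · G · Σ_{p ∈ supp w ∩ S} ‖w p‖`. [folklore] -/
theorem tsum_norm_sq_le_of_residual (hA : Adm₀ A) (hI : Inner₀ t A) {κ : ℝ} (hκ0 : 0 ≤ κ)
    (hκ : ∀ v : (EuclideanSpace ℝ (Fin 3)) → (EuclideanSpace ℝ (Fin 3)), (Function.support v).Finite → Function.support v ⊆ Sites₀ t A →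
      κ * nnForm t A v ≤ ∑' p : Sites₀ t A, ⟪∑' q : Sites₀ t A,
        (if (p : (EuclideanSpace ℝ (Fin 3))) ≠ q then ((-((‖(p : (EuclideanSpace ℝ (Fin 3))) - q‖ ^ 2)⁻¹) ^ 7 + ((‖(p : (EuclideanSpace ℝ (Fin 3))) - q‖ ^ 2)⁻¹) ^ 4) • (v p - v q) + (2 * ⟪(p : (EuclideanSpace ℝ (Fin 3))) - q, v p - v q⟫ * (7 * ((‖(p : (EuclideanSpace ℝ (Fin 3))) - q‖ ^ 2)⁻¹) ^ 8 - 4 * ((‖(p : (EuclideanSpace ℝ (Fin 3))) - q‖ ^ 2)⁻¹) ^ 5)) • ((p : (EuclideanSpace ℝ (Fin 3))) - q)) else 0), v p⟫)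
    {w : (EuclideanSpace ℝ (Fin 3)) → (EuclideanSpace ℝ (Fin 3))} (hw : (Function.support w).Finite) (hwS : Function.support w ⊆ Sites₀ t A)
    {c : (EuclideanSpace ℝ (Fin 3))} {R : ℝ} (hR : 0 ≤ R) (hwR : Function.support w ⊆ Metric.closedBall c R)
    {G : ℝ} (hG : ∀ p : Sites₀ t A, w p ≠ 0 → ‖∑' q : Sites₀ t A, (if (p : (EuclideanSpace ℝ (Fin 3))) ≠ q then ((-((‖(p : (EuclideanSpace ℝ (Fin 3))) - q‖ ^ 2)⁻¹) ^ 7 + ((‖(p : (EuclideanSpace ℝ (Fin 3))) - q‖ ^ 2)⁻¹) ^ 4) • (w p - w q) + (2 * ⟪(p : (EuclideanSpace ℝ (Fin 3))) - q, w p - w q⟫ * (7 * ((‖(p : (EuclideanSpace ℝ (Fin 3))) - q‖ ^ 2)⁻¹) ^ 8 - 4 * ((‖(p : (EuclideanSpace ℝ (Fin 3))) - q‖ ^ 2)⁻¹) ^ 5)) • ((p : (EuclideanSpace ℝ (Fin 3))) - q)) else 0)‖ ≤ G) :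
    κ * ∑' p : Sites₀ t A, ‖w p‖ ^ 2 ≤
      (400 * R / 189 + 2) ^ 2 * (G * ∑ p ∈ (finite_support_sites (t := t) (A := A) hw).toFinset, ‖w p‖) := by
  classical
  have h1 := mul_tsum_norm_sq_le_work hA hI hκ0 hκ hw hwS hR hwR
  set T := (finite_support_sites (t := t) (A := A) hw).toFinset with hT
  have hTm : ∀ p : Sites₀ t A, p ∉ T → w p = 0 := by
    intro p hp
    by_contra h'
    exact hp ((Set.Finite.mem_toFinset _).2 h')
  have hwork : ∑' p : Sites₀ t A, ⟪∑' q : Sites₀ t A, (if (p : (EuclideanSpace ℝ (Fin 3))) ≠ q then ((-((‖(p : (EuclideanSpace ℝ (Fin 3))) - q‖ ^ 2)⁻¹) ^ 7 + ((‖(p : (EuclideanSpace ℝ (Fin 3))) - q‖ ^ 2)⁻¹) ^ 4) • (w p - w q) + (2 * ⟪(p : (EuclideanSpace ℝ (Fin 3))) - q, w p - w q⟫ * (7 * ((‖(p : (EuclideanSpace ℝ (Fin 3))) - q‖ ^ 2)⁻¹) ^ 8 - 4 * ((‖(p : (EuclideanSpace ℝ (Fin 3))) - q‖ ^ 2)⁻¹)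 ^ 5)) • ((p : (EuclideanSpace ℝ (Fin 3))) - q)) else 0), w p⟫ ≤ G * ∑ p ∈ T, ‖w p‖ := by
    rw [tsum_eq_sum (s := T) (fun p hp => by rw [hTm p hp, inner_zero_right]), Finset.mul_sum]
    refine Finset.sum_le_sum fun p _ => ?_
    by_cases hp0 : w p = 0
    · rw [hp0, inner_zero_right, norm_zero, mul_zero]
    · exact (real_inner_le_norm _ _).trans (mul_le_mul_of_nonneg_right (hG p hp0) (norm_nonneg _))
  exact h1.trans (mul_le_mul_of_nonneg_left hwork (by positivity))

end

end Summit.AtomisticToContinuum.Crystallization.Theorems.ExcessDecayLiouville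

end
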